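import Summits.CriticalPhenomena.PercolationContinuityZ3.Theorems.PercNearOneGluingAdditiveGluingCSHHpart
import Literature.Probability.Percolation.TwoSetConditionalAssociation
import HarnessLib

/-!
# The MIXED conditioned slack hierarchy (hub observer) — brick 1: the set four-point transfer (K6) with a HUB observer

Support file (`--supports stmt-CriticalPhenomena-4575`), prover `prim-ineq-gen-7` (gen 8).  No definitions, no named facts, no sorries.
Memo: `prim-ineq-gen-7/PROOF-Q9-MIXED-CSH.md` §3.4 (K6-mix) — first Lean brick of the roadmap (§9.3) towards Kozma–Nitzan's
Question 9 / Conjecture 6 for every `|A|` via the mixed hierarchy (Theorems M1/M2 of the memo).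

In the cell's conditioned slack hierarchy ([W] = `prim-hp-8/CSH-WRITEUP.md`) the observer `o` is a vertex and (K6) reads
`Cov(Ψ(C_x), 1{o ↔ S}) ≥ μ(o ∈ C_v | v ↮ S)·Cov(Ψ(C_x), 1{v ↔ S})` (tree: `CSH.covTransfer_relaySet_edge`).  For Question 9 the observer is
a HUB glued to a set `Σ` of vertices of the relay graph while all conditioning stays in the relay graph; the hub is "in `C_v` and not joined
to `S`" iff `Σ` meets `C_v` and misses the cluster of `S` — a weight increasing in `C_v` and DEcreasing in `C_S`.  vdBHK's Theorem 2.1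
(`q = 1`; tree `BHK2006_twoSetConditionalAssociation`) handles exactly such bi-monotone functions, and (K6) survives verbatim:

* `MixCSH.covTransfer_relaySet_hub` — for `x ∈ S`, `g` monotone `≥ 0` on edge sets, `m = ∫ g(C_x)`, `D = {v ↮ S}`,
  `W = {Σ ∩ C_v ≠ ∅} ∩ {Σ ↮ S}`:   `μ(D ∩ W)·(∫_{v↔S} g(C_x) − μ(v↔S)·m) ≤ μ(D)·(∫_{Σ↔S} g(C_x) − μ(Σ↔S)·m)`.
  For `Σ = {o}` (`o ∉ S`, `o ≠ v`) this is `CSH.covTransfer_relaySet_edge`.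
[cite: VandenbergHaggstromKahn2005, Thm. 2.1 (p. 9) at q = 1, Thm. 1.4 (p. 7), Remark 1 after Thm. 1.2 (p. 5)] [cite: KozmaNitzan2024, Question 9 (§5.5 p. 36), Conj. 4 (p. 32)]
-/

noncomputable section

namespace Summit.CriticalPhenomena.PercolationContinuityZ3.Theorems

open MeasureTheory Set
open Literature.Probability.LatticeModels (prodBernoulli)
open Literature.Probability.Percolation Literature.Probability.Percolation.KNPreFKG
open Literature.Probability.Percolation.BHK2006 (openEdgeCluster_mono)
open scoped Classical

namespace MixCSH

variable {V : Type*} [Fintype V]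

omit [Fintype V] in
/-- The family of edge sets of a vertex SET `S` that meet `Σ`: some `σ ∈ Σ` lies in `S` or on an edge of the set. An upper family;
`{Σ ↔ S} = {C_S ∈ hubHitFamily Σ S}`. [cite: VandenbergHaggstromKahn2005, §1 p. 3, Remark 1 (p. 5)] -/
theorem isUpperSet_setHit (Sig S : Set V) :
    IsUpperSet {C : Set (Sym2 V) | ∃ σ ∈ Sig, σ ∈ S ∨ ∃ e ∈ C, σ ∈ e} := by
  intro C C' hCC' hC
  obtain ⟨σ, hσ, h⟩ := hC
  rcases h with h | ⟨e, he, hσe⟩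
  · exact ⟨σ, hσ, Or.inl h⟩
  · exact ⟨σ, hσ, Or.inr ⟨e, hCC' he, hσe⟩⟩

omit [Fintype V] in
/-- `{Σ ↔ S}` (some vertex of `Σ` joined to some vertex of `S`) read off the edge cluster `C_S = ⋃_{t∈S} C_t`. [cite: VandenbergHaggstromKahn2005, Remark 1 after Thm. 1.2 (p. 5)] -/
theorem setOf_setHit_eq (Sig S : Set V) :
    {ω : BondConfig V | ∃ σ ∈ Sig, ∃ t ∈ S, (openGraph ω).Reachable t σ} =
      {ω | (⋃ t ∈ S, openEdgeCluster ω t) ∈ {C : Set (Sym2 V) | ∃ σ ∈ Sig, σ ∈ S ∨ ∃ e ∈ C, σ ∈ e}} := by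
  ext ω
  simp only [mem_setOf_eq, mem_iUnion, exists_prop]
  constructor
  · rintro ⟨σ, hσ, t, ht, htσ⟩
    rcases (reachable_iff_exists_mem_openEdgeCluster ω t σ).1 htσ with h | ⟨e, he, hσe⟩
    · exact ⟨σ, hσ, Or.inl (h ▸ ht)⟩
    · exact ⟨σ, hσ, Or.inr ⟨e, ⟨t, ht, he⟩, hσe⟩⟩
  · rintro ⟨σ, hσ, h | ⟨e, ⟨t, ht, he⟩, hσe⟩⟩
    · exact ⟨σ, hσ, σ, h, SimpleGraph.Reachable.refl _⟩
    · exact ⟨σ, hσ, t, ht, (reachable_iff_exists_mem_openEdgeCluster ω t σ).2 (Or.inr ⟨e, he, hσe⟩)⟩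

/-- **(K6) with a HUB observer** (memo §3.4 K6-mix).  `x ∈ S`, `g` monotone nonnegative on edge sets, `m = ∫ g(C_x)`, `D = {v ↮ S}`,
`W = {Σ ∩ C_v ≠ ∅} ∩ {Σ ↮ S}` (the hub glued to `Σ` lies in `C_v` and is not joined to `S`):
`μ(D ∩ W)·(∫_{v↔S} g(C_x) − μ(v↔S)·m) ≤ μ(D)·(∫_{Σ↔S} g(C_x) − μ(Σ↔S)·m)`.
Proof: `{Σ ↔ S ∪ {v}} = {Σ ↔ S} ⊔ (D ∩ W)`; Harris on the increasing event `{Σ ↔ S ∪ {v}}`; and vdBHK Thm 2.1 given `{v} ↮ S` for the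
bi-monotone weight `1_W` (increasing in `C_v`, decreasing in `C_S`) against `g(C_x)` (increasing in `C_S`, `C_x` being read inside `C_S`).
[cite: VandenbergHaggstromKahn2005, Thm. 2.1 (p. 9) at q = 1; Thm. 1.4 (p. 7)] [cite: KozmaNitzan2024, Question 9 (§5.5 p. 36)] -/
theorem covTransfer_relaySet_hub (w : Sym2 V → unitInterval) (S : Finset V) (Sig : Set V) (v x : V) (hxS : x ∈ S)
    (g : Set (Sym2 V) → ℝ) (hg : Monotone g) (hg0 : ∀ C, 0 ≤ g C) :
    (prodBernoulli w).real ({ω : BondConfig V | ∀ t ∈ S, ¬ (openGraph ω).Reachable v t} ∩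
        ({ω | ∃ σ ∈ Sig, (openGraph ω).Reachable v σ} ∩ {ω | ∀ σ ∈ Sig, ∀ t ∈ S, ¬ (openGraph ω).Reachable t σ})) *
        (∫ ω in (⋃ t ∈ S, openConn v t), g (openEdgeCluster ω x) ∂(prodBernoulli w) -
          (prodBernoulli w).real (⋃ t ∈ S, openConn v t) * ∫ ω, g (openEdgeCluster ω x) ∂(prodBernoulli w)) ≤
      (prodBernoulli w).real {ω : BondConfig V | ∀ t ∈ S, ¬ (openGraph ω).Reachable v t} *
        (∫ ω in {ω : BondConfig V | ∃ σ ∈ Sig, ∃ t ∈ S, (openGraph ω).Reachable t σ}, g (openEdgeCluster ω x) ∂(prodBernoulli w) -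
          (prodBernoulli w).real {ω : BondConfig V | ∃ σ ∈ Sig, ∃ t ∈ S, (openGraph ω).Reachable t σ} *
            ∫ ω, g (openEdgeCluster ω x) ∂(prodBernoulli w)) := by
  set μ := prodBernoulli w with hμ
  set f : BondConfig V → ℝ := fun ω => g (openEdgeCluster ω x) with hf
  set m : ℝ := ∫ ω, f ω ∂μ with hm
  have hmeas : ∀ T : Set (BondConfig V), MeasurableSet T := fun _ => MeasurableSet.of_discrete
  have hint : ∀ (k : BondConfig V → ℝ) (T : Set (BondConfig V)), IntegrableOn k T μ :=
    fun k T => (Integrable.of_finite).integrableOn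
  have hn := fun (T : Set (BondConfig V)) => (measureReal_nonneg : 0 ≤ μ.real T)
  set D : Set (BondConfig V) := {ω | ∀ t ∈ S, ¬ (openGraph ω).Reachable v t} with hD
  set OT : Set (BondConfig V) := {ω | ∃ σ ∈ Sig, ∃ t ∈ S, (openGraph ω).Reachable t σ} with hOT
  set Hv : Set (BondConfig V) := {ω | ∃ σ ∈ Sig, (openGraph ω).Reachable v σ} with hHv
  set AS : Set (BondConfig V) := {ω | ∀ σ ∈ Sig, ∀ t ∈ S, ¬ (openGraph ω).Reachable t σ} with hAS
  set Q : Set (BondConfig V) := ⋃ t ∈ S, openConn v t with hQ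
  set U : Set (BondConfig V) := OT ∪ Hv with hU
  -- (1) Harris on the increasing event `U = {Σ ↔ S ∪ {v}}`
  have hupT : IsUpperSet OT := by
    intro ω ω' hle hω
    obtain ⟨σ, hσ, t, ht, h⟩ := hω
    exact ⟨σ, hσ, t, ht, h.mono (openGraph_mono hle)⟩
  have hupV : IsUpperSet Hv := by
    intro ω ω' hle hω
    obtain ⟨σ, hσ, h⟩ := hω
    exact ⟨σ, hσ, h.mono (openGraph_mono hle)⟩
  have hHarris : μ.real U * m ≤ ∫ ω in U, f ω ∂μ := CSH.setIntegral_edgeFun_ge w x g hg hg0 U (hupT.union hupV)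
  -- (2) two-set vdBHK given `{v} ↮ S`: the bi-monotone weight `1{Σ ∩ C_v ≠ ∅}·1{Σ ↮ S}` against `g(C_x)` (increasing in `C_S`)
  set 𝒰v : Set (Set (Sym2 V)) := {C | ∃ σ ∈ Sig, σ ∈ ({v} : Set V) ∨ ∃ e ∈ C, σ ∈ e} with h𝒰v
  set 𝒰S : Set (Set (Sym2 V)) := {C | ∃ σ ∈ Sig, σ ∈ (↑S : Set V) ∨ ∃ e ∈ C, σ ∈ e} with h𝒰S
  set Wf : Set (Sym2 V) → Set (Sym2 V) → ℝ := fun Cv CS => 𝒰v.indicator 1 Cv * 𝒰Sᶜ.indicator 1 CS with hWf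
  have hWf1 : ∀ CS, Monotone fun Cv => Wf Cv CS := fun CS C C' hCC' =>
    mul_le_mul_of_nonneg_right (monotone_indicator_one_of_isUpperSet (isUpperSet_setHit Sig {v}) hCC')
      (indicator_nonneg (fun _ _ => zero_le_one) _)
  have hWf2 : ∀ Cv, Antitone fun CS => Wf Cv CS := fun Cv C C' hCC' =>
    mul_le_mul_of_nonneg_left
      (antitone_indicator_one_of_isLowerSet (isUpperSet_setHit Sig (↑S : Set V)).compl hCC')
      (indicator_nonneg (fun _ _ => zero_le_one) _)
  set Gf : Set (Sym2 V) → Set (Sym2 V) → ℝ := fun _ CS => -g (openEdgeCluster CS x) with hGf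
  have hGf1 : ∀ CS, Monotone fun Cv => Gf Cv CS := fun _ => monotone_const
  have hGf2 : ∀ Cv, Antitone fun CS => Gf Cv CS := fun _ C C' hCC' => neg_le_neg (hg (openEdgeCluster_mono hCC' x))
  have hBHK := BHK2006_twoSetConditionalAssociation w ({v} : Set V) (↑S : Set V) Wf Gf hWf1 hWf2 hGf1 hGf2
  have hDset : {ω : BondConfig V | ∀ s ∈ ({v} : Set V), ∀ t ∈ (↑S : Set V), ¬ (openGraph ω).Reachable s t} = D := by
    ext ω; simp [hD]
  have hGval : ∀ ω : BondConfig V, Gf (⋃ s ∈ ({v} : Set V), openEdgeCluster ω s) (⋃ t ∈ (↑S : Set V), openEdgeCluster ω t) = -f ω :=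
    fun ω => by simp only [hGf, hf]; rw [CovTauStarN.openEdgeCluster_biUnion_eq (Finset.mem_coe.2 hxS)]
  have hWval : ∀ ω : BondConfig V, Wf (⋃ s ∈ ({v} : Set V), openEdgeCluster ω s) (⋃ t ∈ (↑S : Set V), openEdgeCluster ω t) =
      (Hv ∩ AS).indicator 1 ω := by
    intro ω
    have hmem1 : ω ∈ Hv ↔ (⋃ s ∈ ({v} : Set V), openEdgeCluster ω s) ∈ 𝒰v := by
      constructor
      · rintro ⟨σ, hσ, hvσ⟩
        rcases (reachable_iff_exists_mem_openEdgeCluster ω v σ).1 hvσ with h | ⟨e, he, hσe⟩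
        · exact ⟨σ, hσ, Or.inl (h ▸ mem_singleton v)⟩
        · exact ⟨σ, hσ, Or.inr ⟨e, mem_iUnion₂.2 ⟨v, mem_singleton v, he⟩, hσe⟩⟩
      · rintro ⟨σ, hσ, h | ⟨e, he, hσe⟩⟩
        · exact ⟨σ, hσ, (mem_singleton_iff.1 h) ▸ SimpleGraph.Reachable.refl _⟩
        · obtain ⟨t, ht, he'⟩ := mem_iUnion₂.1 he
          have htv : t = v := mem_singleton_iff.1 ht
          subst htv
          exact ⟨σ, hσ, (reachable_iff_exists_mem_openEdgeCluster ω t σ).2 (Or.inr ⟨e, he', hσe⟩)⟩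
    have hmem2 : ω ∈ AS ↔ (⋃ t ∈ (↑S : Set V), openEdgeCluster ω t) ∈ 𝒰Sᶜ := by
      have h' := Set.ext_iff.1 (setOf_setHit_eq Sig (↑S : Set V)) ω
      rw [mem_compl_iff]
      constructor
      · intro hAS' hmem
        obtain ⟨σ, hσ, t, ht, htσ⟩ := h'.2 hmem
        exact hAS' σ hσ t (Finset.mem_coe.1 ht) htσ
      · intro hn σ hσ t ht htσ
        exact hn (h'.1 ⟨σ, hσ, t, Finset.mem_coe.2 ht, htσ⟩)
    have e1 : 𝒰v.indicator (1 : Set (Sym2 V) → ℝ) (⋃ s ∈ ({v} : Set V), openEdgeCluster ω s) = Hv.indicator 1 ω := by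
      by_cases h : ω ∈ Hv
      · rw [indicator_of_mem h, indicator_of_mem (hmem1.1 h)]; rfl
      · rw [indicator_of_notMem h, indicator_of_notMem (fun h' => h (hmem1.2 h'))]
    have e2 : 𝒰Sᶜ.indicator (1 : Set (Sym2 V) → ℝ) (⋃ t ∈ (↑S : Set V), openEdgeCluster ω t) = AS.indicator 1 ω := by
      by_cases h : ω ∈ AS
      · rw [indicator_of_mem h, indicator_of_mem (hmem2.1 h)]; rfl
      · rw [indicator_of_notMem h, indicator_of_notMem (fun h' => h (hmem2.2 h'))]
    simp only [hWf, e1, e2]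
    exact congrFun (indicator_one_mul_indicator_one Hv AS) ω
  simp only [hDset, hGval, hWval, mul_neg, integral_neg] at hBHK
  have hprod : ∫ ω in D, (Hv ∩ AS).indicator (1 : BondConfig V → ℝ) ω * f ω ∂μ = ∫ ω in D ∩ (Hv ∩ AS), f ω ∂μ := by
    rw [← setIntegral_mul_indicator_one μ D (Hv ∩ AS) f]
    refine setIntegral_congr_fun (hmeas D) fun ω _ => ?_
    ring
  rw [setIntegral_indicator_one_eq, hprod] at hBHK
  -- hBHK : ∫_D W * -(∫_D f) ≤ μ D * -(∫_{D∩W} f)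
  have hBHK' : μ.real D * ∫ ω in D ∩ (Hv ∩ AS), f ω ∂μ ≤ μ.real (D ∩ (Hv ∩ AS)) * ∫ ω in D, f ω ∂μ := by linarith
  -- (3) `U = OT ⊔ (D ∩ W)`
  have hUdiff : U \ OT = D ∩ (Hv ∩ AS) := by
    ext ω
    simp only [hU, hOT, hHv, hAS, hD, mem_sdiff, mem_union, mem_inter_iff, mem_setOf_eq, not_exists, not_and]
    constructor
    · rintro ⟨h | h, hno⟩
      · obtain ⟨σ, hσ, t, ht, h'⟩ := h
        exact absurd h' (hno σ hσ t ht)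
      · obtain ⟨σ, hσ, hvσ⟩ := h
        refine ⟨fun t ht hvt => hno σ hσ t ht (hvt.symm.trans hvσ), ⟨σ, hσ, hvσ⟩, fun σ' hσ' t ht htσ' => hno σ' hσ' t ht htσ'⟩
    · rintro ⟨_, hv', has⟩
      exact ⟨Or.inr hv', fun σ hσ t ht h => has σ hσ t ht h⟩
  have hUint : ∫ ω in U, f ω ∂μ = ∫ ω in OT, f ω ∂μ + ∫ ω in D ∩ (Hv ∩ AS), f ω ∂μ := by
    rw [← integral_inter_add_sdiff (hmeas OT) (hint f U), inter_eq_right.2 subset_union_left, hUdiff]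
  have hUμ : μ.real U = μ.real OT + μ.real (D ∩ (Hv ∩ AS)) := by
    rw [← measureReal_inter_add_sdiff (s := U) (h := measure_ne_top _ _) (hmeas OT), inter_eq_right.2 subset_union_left, hUdiff]
  -- (4) `D = Qᶜ`
  have hDQ : D = Qᶜ := by
    ext ω
    simp [hD, hQ, openConn]
  have hDint : ∫ ω in D, f ω ∂μ = m - ∫ ω in Q, f ω ∂μ := by
    have := integral_add_compl (hmeas Q) (Integrable.of_finite (f := f) (μ := μ))
    rw [← hDQ] at this
    linarith
  have hDμ : μ.real D = 1 - μ.real Q := by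
    have h1 : μ.real (univ : Set (BondConfig V)) = μ.real (univ ∩ Q) + μ.real (univ \ Q) :=
      (measureReal_inter_add_sdiff (s := univ) (h := measure_ne_top _ _) (hmeas Q)).symm
    rw [probReal_univ, univ_inter, ← compl_eq_univ_sdiff, ← hDQ] at h1
    linarith
  -- assemble
  have hA : ∫ ω in OT, f ω ∂μ - μ.real OT * m ≥ μ.real (D ∩ (Hv ∩ AS)) * m - ∫ ω in D ∩ (Hv ∩ AS), f ω ∂μ := by
    rw [hUint, hUμ] at hHarris
    linarith
  have hB : μ.real D * (μ.real (D ∩ (Hv ∩ AS)) * m - ∫ ω in D ∩ (Hv ∩ AS), f ω ∂μ) ≥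
      μ.real D * (μ.real (D ∩ (Hv ∩ AS)) * m) - μ.real (D ∩ (Hv ∩ AS)) * ∫ ω in D, f ω ∂μ := by
    rw [mul_sub]
    linarith [hBHK']
  have hC := mul_le_mul_of_nonneg_left hA (hn D)
  rw [hDint, hDμ] at hB
  rw [hDμ] at hC ⊢
  nlinarith [hB, hC, hn (D ∩ (Hv ∩ AS)), hn Q]

end MixCSH

end Summit.CriticalPhenomena.PercolationContinuityZ3.Theorems
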